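import Summits.ValiantsHypothesis.ValiantsHypothesis.Theorems.BarrierLeverAnchoredDoorHitsLowerPairsXElimRecursion

/-!
# Support item `AnchoredDoorHitsLowerPairs` (stmt-ValiantsHypothesis-22510), line `anchored-peeling`:
# THE RESIDUAL OF RECORD MINUS X-ELIMINATION CERTIFICATE PAIRS (registry v28 candidate, planner RULING R37)

Helper file (`--supports stmt-ValiantsHypothesis-22510`; cell valiant-natproofs, rung V4; prover seat val-np-p1 gen 26; memo
HOME/val-np-p1/g26/MEMO-conjZ-node-valnp1-g26.md §6).

The registered residual of record (registry v27) is the glued pair (`Stmt.stub_conjZ`, `Stmt.stub_ltRestNonCanonRSWZ`) of `…ConjZ` (p695484). The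
x-elimination class theorem `XElim.symbolicDet_ne_zero_of_isXCertPair` (`…XElimRecursion`, p699080) hits every certificate pair at every profile `s ≥ 2`
UNCONDITIONALLY. This file offers the planner's pre-ruled 1:1 swap (STATUS ruling R37):

* `Stmt.stub_ltRestNonCanonRSWXZ` — the text of `Stmt.stub_ltRestNonCanonRSWZ` VERBATIM plus two further hypotheses «no x-elimination certificate on either
  side» (`¬ XElim.IsXCertPair u w`, `¬ XElim.IsXCertPair w u`); WEAKER than RSWZ;
* the glue `stub_ltRestNonCanonRSWZ_of_rswxz : RSWXZ → RSWZ` (unconditional: case split on the certificate, `symbolicDet_ne_zero_of_isXCertPair` +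
  `symbolicDet_ne_zero_comm`), the trivial converse-direction arrows `stub_ltRestNonCanonRSWXZ_of_rswz`, `stub_ltRestNonCanonRSWXZ_of_rswx` (RSWXZ is implied by
  each of RSWZ, RSWX), and the compositions BY NAME `stub_ltRestNonCanonRSW_of_conjZ_rswxz`, `anchoredDoorHitsLowerPairs_of_conjZ_rswxz :
  Stmt.stub_conjZ → Stmt.stub_ltRestNonCanonRSWXZ → AnchoredDoorHitsLowerPairs`.

WHAT THIS IS NOT: the residual class RSWXZ is not shown empty or hit; nothing on crux stmt-ValiantsHypothesis-14610 or on `VP` versus `VNP`.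
-/

set_option linter.dupNamespace false

namespace Summit.ValiantsHypothesis.ValiantsHypothesis.Theorems.BarrierLever.AnchoredPeeling

/-- **STUB TEXT (offered, RULING R37): THE RESIDUAL OF RECORD MINUS X-ELIMINATION CERTIFICATE PAIRS.** The text of `Stmt.stub_ltRestNonCanonRSWZ` (p695484,
registered v27) VERBATIM with two further hypotheses: the pair has no x-elimination certificate (`XElim.IsXCertPair`, p699080) in either orientation. WEAKER
than `Stmt.stub_ltRestNonCanonRSWZ` — UNCONDITIONALLY (glue `stub_ltRestNonCanonRSWZ_of_rswxz`). Every named residual pair of the line's censuses is a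
certificate pair (lab/xcert2.py, kit j326272 / j326800; kernel instances `XElim.Instances.*`). WHY IT MIGHT FAIL: a doubly non-nested-Hall, data-free, LT-free,
non-canonical, non-split, non-weighted-apex pair without certificate on either side whose symbolic minor vanishes at the chosen profile. -/
def Stmt.stub_ltRestNonCanonRSWXZ : Prop :=
  ∃ s h₀ : ℕ, 2 ≤ s ∧ ∀ h : ℕ, h₀ ≤ h → ∀ (r : ℕ) (u w : Fin r → Finset (Fin h)),
    Function.Injective u → Function.Injective w → IsLowerSet (Set.range u) → IsLowerSet (Set.range w) → 2 ≤ r →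
    (∀ (a : Fin h) (W₀ : Finset (Fin h)) (𝒜 : Finset (Finset (Fin h))) (ρ : Finset (Fin h) → Finset (Fin h)), ¬ UQFData s u w a W₀ 𝒜 ρ) →
    (∀ (c : Fin h) (Z : Finset (Fin h)) (𝒜 : Finset (Finset (Fin h))) (ρ : Finset (Fin h) → Finset (Fin h)), ¬ UQFData s w u c Z 𝒜 ρ) →
    ¬ Summit.ValiantsHypothesis.ValiantsHypothesis.Theorems.BarrierLever.AnchoredPeeling.IsRelApexPair u w → ¬ Summit.ValiantsHypothesis.ValiantsHypothesis.Theorems.BarrierLever.AnchoredPeeling.IsRelApexPair w u → ¬ Summit.ValiantsHypothesis.ValiantsHypothesis.Theorems.BarrierLever.AnchoredPeeling.LTCert u w → ¬ Summit.ValiantsHypothesis.ValiantsHypothesis.Theorems.BarrierLever.AnchoredPeeling.LTCert w u →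
    (¬ ∃ (k : ℕ) (σ τ : Equiv.Perm (Fin h)), 1 ≤ k ∧ 2 * k + 1 ≤ h ∧ 2 ^ (k + 1) - 1 ≤ h ∧
        (∀ U : Finset (Fin h), U ∈ Set.range u ↔ Summit.ValiantsHypothesis.ValiantsHypothesis.Theorems.BarrierLever.AnchoredPeeling.DecRow k h (U.map σ.toEmbedding)) ∧
        (∀ W : Finset (Fin h), W ∈ Set.range w ↔ Summit.ValiantsHypothesis.ValiantsHypothesis.Theorems.BarrierLever.AnchoredPeeling.DecCol k h (W.map τ.toEmbedding))) →
    (¬ ∃ (k : ℕ) (σ τ : Equiv.Perm (Fin h)), 1 ≤ k ∧ 2 * k + 1 ≤ h ∧ 2 ^ (k + 1) - 1 ≤ h ∧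
        (∀ U : Finset (Fin h), U ∈ Set.range w ↔ Summit.ValiantsHypothesis.ValiantsHypothesis.Theorems.BarrierLever.AnchoredPeeling.DecRow k h (U.map σ.toEmbedding)) ∧
        (∀ W : Finset (Fin h), W ∈ Set.range u ↔ Summit.ValiantsHypothesis.ValiantsHypothesis.Theorems.BarrierLever.AnchoredPeeling.DecCol k h (W.map τ.toEmbedding))) →
    (¬ ∃ (m : ℕ) (σ τ : Equiv.Perm (Fin h)), 1 ≤ m ∧ 2 * m + 2 ≤ h ∧ 2 ^ (m + 1) + 2 ^ m - 1 ≤ h ∧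
        (∀ U : Finset (Fin h), U ∈ Set.range u ↔ Summit.ValiantsHypothesis.ValiantsHypothesis.Theorems.BarrierLever.AnchoredPeeling.SplitRow m h (U.map σ.toEmbedding)) ∧
        (∀ W : Finset (Fin h), W ∈ Set.range w ↔ Summit.ValiantsHypothesis.ValiantsHypothesis.Theorems.BarrierLever.AnchoredPeeling.SplitCol m h (W.map τ.toEmbedding))) →
    (¬ ∃ (m : ℕ) (σ τ : Equiv.Perm (Fin h)), 1 ≤ m ∧ 2 * m + 2 ≤ h ∧ 2 ^ (m + 1) + 2 ^ m - 1 ≤ h ∧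
        (∀ U : Finset (Fin h), U ∈ Set.range w ↔ Summit.ValiantsHypothesis.ValiantsHypothesis.Theorems.BarrierLever.AnchoredPeeling.SplitRow m h (U.map σ.toEmbedding)) ∧
        (∀ W : Finset (Fin h), W ∈ Set.range u ↔ Summit.ValiantsHypothesis.ValiantsHypothesis.Theorems.BarrierLever.AnchoredPeeling.SplitCol m h (W.map τ.toEmbedding))) →
    ¬ IsWApexPair u w → ¬ IsWApexPair w u →
    (¬ ∀ d : ℕ, 1 ≤ d →
      (Finset.univ.filter (fun j : Fin r => 2 * d - 1 ≤ (w j).card)).card ≤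
        (Finset.univ.filter (fun i : Fin r => d ≤ (u i).card)).card) →
    (¬ ∀ d : ℕ, 1 ≤ d →
      (Finset.univ.filter (fun i : Fin r => 2 * d - 1 ≤ (u i).card)).card ≤
        (Finset.univ.filter (fun j : Fin r => d ≤ (w j).card)).card) →
    ¬ XElim.IsXCertPair u w → ¬ XElim.IsXCertPair w u →
    symbolicDet s h r u w ≠ 0

/-- **Kernel glue (UNCONDITIONAL; RULING R37): the residual of record minus certificate pairs ⟹ the residual of record `Stmt.stub_ltRestNonCanonRSWZ`.** -/
theorem stub_ltRestNonCanonRSWZ_of_rswxz (hR : Stmt.stub_ltRestNonCanonRSWXZ) : Stmt.stub_ltRestNonCanonRSWZ := by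
  obtain ⟨s, h₀, hs, H⟩ := hR
  refine ⟨s, h₀, hs, ?_⟩
  intro h hh r u w hu hw hlu hlw hr hA hB hRA hRB hLA hLB hc hc' hd hd' hwa hwb hNH hNH'
  by_cases hx : XElim.IsXCertPair u w
  · exact XElim.symbolicDet_ne_zero_of_isXCertPair hs hu hw hx
  · by_cases hy : XElim.IsXCertPair w u
    · exact (symbolicDet_ne_zero_comm s h r u w).mpr (XElim.symbolicDet_ne_zero_of_isXCertPair hs hw hu hy)
    · exact H h hh r u w hu hw hlu hlw hr hA hB hRA hRB hLA hLB hc hc' hd hd' hwa hwb hNH hNH' hx hy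

/-- The trivial direction: the residual of record implies its narrowing. -/
theorem stub_ltRestNonCanonRSWXZ_of_rswz (hR : Stmt.stub_ltRestNonCanonRSWZ) : Stmt.stub_ltRestNonCanonRSWXZ := by
  obtain ⟨s, h₀, hs, H⟩ := hR
  refine ⟨s, h₀, hs, ?_⟩
  intro h hh r u w hu hw hlu hlw hr hA hB hRA hRB hLA hLB hc hc' hd hd' hwa hwb hNH hNH' _ _
  exact H h hh r u w hu hw hlu hlw hr hA hB hRA hRB hLA hLB hc hc' hd hd' hwa hwb hNH hNH'

/-- The trivial direction from the Z-free narrowing `Stmt.stub_ltRestNonCanonRSWX` (p699080). -/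
theorem stub_ltRestNonCanonRSWXZ_of_rswx (hR : Stmt.stub_ltRestNonCanonRSWX) : Stmt.stub_ltRestNonCanonRSWXZ := by
  obtain ⟨s, h₀, hs, H⟩ := hR
  refine ⟨s, h₀, hs, ?_⟩
  intro h hh r u w hu hw hlu hlw hr hA hB hRA hRB hLA hLB hc hc' hd hd' hwa hwb _ _ hx hy
  exact H h hh r u w hu hw hlu hlw hr hA hB hRA hRB hLA hLB hc hc' hd hd' hwa hwb hx hy

/-- **Composition: Z + the narrowed residual ⟹ the registered residual `Stmt.stub_ltRestNonCanonRSW` (v26 text).** -/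
theorem stub_ltRestNonCanonRSW_of_conjZ_rswxz (hZ : Stmt.stub_conjZ) (hR : Stmt.stub_ltRestNonCanonRSWXZ) : Stmt.stub_ltRestNonCanonRSW :=
  stub_ltRestNonCanonRSW_of_conjZ_rswz hZ (stub_ltRestNonCanonRSWZ_of_rswxz hR)

/-- **Composition BY NAME (registry v28 candidate): `Stmt.stub_conjZ → Stmt.stub_ltRestNonCanonRSWXZ → AnchoredDoorHitsLowerPairs`.** -/
theorem anchoredDoorHitsLowerPairs_of_conjZ_rswxz (hZ : Stmt.stub_conjZ) (hR : Stmt.stub_ltRestNonCanonRSWXZ) :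
    Summit.ValiantsHypothesis.ValiantsHypothesis.Theses.BarrierLever.AnchoredDoorHitsLowerPairs :=
  anchoredDoorHitsLowerPairs_of_conjZ_rswz hZ (stub_ltRestNonCanonRSWZ_of_rswxz hR)

end Summit.ValiantsHypothesis.ValiantsHypothesis.Theorems.BarrierLever.AnchoredPeeling
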